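import Literature.MathematicalPhysics.QuantumFieldTheory.Balaban1983to89.Beta.RemainderDecay190HoloChain
import Literature.MathematicalPhysics.QuantumFieldTheory.Balaban1983to89.Beta.RemainderLocalitySockets

/-!
# `BalabanUV.Gaps.D4NodeEConvergence` — cell `pub-balaban-gaps` (YM blitz Y1), track G1, seat g1-p1 (gen 3; g1-plan-1's OPTIONAL hand-off §7 (b),
# skeleton `HOME/g1/skeletons/D4NodeOTarget.lean` v3 e652f6e491634a13 §4): **ROW (D4), NODE E — THE (1.21) CONVERGENCE FIELD `hconv` OF THE (190)-SOCKET
# `Beta.RemainderDecay190.Data190`, AS A DICHOTOMY: (a) a LIMIT from decay + periodisation (Bałaban's torus test configurations), (b) eventual constancy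
# (window-truncated ℤ^d instruments ONLY)**

HONEST FRAMING (page 1, cell contract).  WHAT THIS IS: two [folklore] hypothesis-to-field lemmas over the abstract (190)-socket `Data190 d M N Wn q` of
`Beta.RemainderDecay190` — the shape in which the leaf lists of row (D4) (`RemainderDecay190HoloChain.ChainTFac190H`, the currency of record
`…ChainTFac190H.abs_beta1_le`) consume the test-vector convergence [I] (1.21).  (a) `hconv_of_periodisedColumns`: if NODE O's instruments at `(Y, x)` on the
`n`-th torus (side `N n · M`) are, after a FIXED continuous linear identification `Φ Y`, the restrictions to a finite window `e Y` of the COLUMN at `[x]` of the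
periodisation of a ℤ^d kernel `S Y` that is jointly `N n · M`-periodic and decays exponentially, and `N n → ∞`, then `hconv` HOLDS with the limit test vector
`t Y x = Φ Y ((S Y (e Y i, x))_i)` — BY NAME from the β sub-cell's `Beta.RemainderLocalitySockets.hconv_periodise₂_cubes` (entrywise volume limit) and the
continuity of `Φ Y`; (b) `hconv_of_eventuallyEq`: eventual constancy of the instruments gives `hconv` with the constant value (no analysis) — the reading for
WINDOW-TRUNCATED ℤ^d instruments only, NOT for Bałaban's torus test configurations (periodised columns MOVE with `n`, road-P3 cross-read X87 = C-d4p3-125,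
`Summits/…/Beta/RemainderExplicitCarrier.r_tc_apply`; for those, (a)).  WHAT THIS IS NOT: not an instance of NODE O (no object of Bałaban's is constructed:
`S`, `Φ`, `e`, `r`, `t` are parameters), not (D4), not Lemma 3, not an estimate; nothing of Bałaban's papers asserted or discharged ([I] p. 264 states (1.21) as a
limit: «This limit exists by the localized representation (1.7)» — quoted, not used); NOT `BetaPertH`, NOT the continuum limit, NOT Clay.
HONEST DEPENDENCY (verbatim): continuum YM on T⁴ ⇐ BetaPertH ∧ nine spine estimates (0/9 proved); BetaPertH ⇐ (D1) ∧ (D4) ∧ CAP+tail; G-an2-4 gates asym,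
D1 and NE2/3/4.

WHY A `Gaps/` FILE.  g1-plan-1's (D4) plan (`HOME/g1/G1-PLAN-D4.md` NODE E; ROUTES-PLAN-1 note 9 (a)) books `hconv` as the FIRST pure-bookkeeping field of the NODE-O
target: under reading (a) the ONLY object-level inputs of NODE E are entrywise decay + joint periodicity + finitely many read-out points — the same (5.10)-type
input road P3 takes from `RemainderExplicitCarrier.exists_decay_carrierBal` ∕ `limit_carrierBal`.  The skeleton (rc 0, 0 sorry) carried the two lemmas inside the
NODE-O target record; this file lands them STANDALONE over `Data190`, so any inhabitant (an4's `RemainderStepAdapterHolo.StepObjectD4`, road P3's carrier, a future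
instance) can cite them by name; the CONSUMERS of exactly this `hconv` field shape are g1-p2's `Gaps.D4FromNE5Activities.abs_beta1_le_of_activities_at`
(p343951-lineage, its binder `hconv`) and ne5's `Spine.NE5.StepObjectFromActivities.polLeavesTFac190HOfActivities` (p343082).  Instance count of row (D4): 0∕1, unchanged.

ABSOLUTE RULE (cell charter, verbatim): «No internally-minted statement may enter as a cited fact. Every hypothesis is either kernel-proved in this package or a
verbatim quotation of a PUBLISHED theorem with page reference.»  No `def`, no `def … : Prop`, nothing cited as mathematics, 0 sorry, axioms ⊆ the standard trio.
Provenance: cell pub-balaban-gaps, seat g1-p1 gen 3 (statements = g1-plan-1's skeleton v3 §4 verbatim, road-P3 X87 folded there), 2026-08-23; imports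
`Beta.RemainderDecay190HoloChain` (for `Data190` and the torus domain words) + `Beta.RemainderLocalitySockets` only; no existing file touched.
-/

noncomputable section

open Literature.MathematicalPhysics.QuantumFieldTheory.Balaban1983to89
open Literature.MathematicalPhysics.QuantumFieldTheory.Balaban1983to89.B13ScaleTransfer (Pt)
open Literature.MathematicalPhysics.QuantumFieldTheory.Balaban1983to89.TreeLengthTorus (proj)
open Literature.MathematicalPhysics.QuantumFieldTheory.Balaban1983to89.Beta.RemainderLimitTorus (LDom tproj)
open Literature.MathematicalPhysics.QuantumFieldTheory.Balaban1983to89.Beta.RemainderDecay190 (Data190 Consts190)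
open Literature.MathematicalPhysics.QuantumFieldTheory.Balaban1983to89.Beta (Kernel₂ IsPeriodic₂ Decay₂ periodise₂)
open Literature.MathematicalPhysics.QuantumFieldTheory.Balaban1983to89.Beta.RemainderLocalitySockets (restrictCLM hconv_periodise₂_cubes)
open Filter
open scoped Topology

namespace Summit.QuantumFields.BalabanUV.Gaps.D4NodeEConvergence

variable {d : ℕ} {M : ℕ} [NeZero M] {q : Consts190}

/-! ## §1 Reading (a): (1.21) as a LIMIT, from decay + periodisation — Bałaban's torus test configurations -/

/-- [folklore] **(a) THE (1.21) CONVERGENCE FIELD FROM DECAY + PERIODISATION.**  If the instruments `r n Y (h_n(Y, x))` of a (190)-socket `D` on the `n`-th torus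
(side `N n · M`) are, after a FIXED continuous linear identification `Φ Y` of the window coordinates with the fibre `V Y`, the RESTRICTIONS to the finite window
`e Y` of the COLUMN at `[x]` of the periodisation of a ℤ^d kernel `S Y` (`hid`) that is jointly periodic under every period `N n · M` (`hS`) and decays
exponentially (`hdec`, `δ > 0`), and `N n → ∞` (`hN`), then the socket's convergence field holds with the limit test vector `t Y x = Φ Y ((S Y (e Y i) x)_i)`
(`ht`): `r n Y (h_n(Y, x)) → t Y x`.  `Beta.RemainderLocalitySockets.hconv_periodise₂_cubes` composed with the continuity of `Φ Y`.  A hypothesis-to-field lemma: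
`S Φ e r t` are parameters, nothing of Bałaban's (4.35) is instantiated. -/
theorem hconv_of_periodisedColumns {N : ℕ → ℕ} [∀ n, NeZero (N n)] {Wn : ℕ → Type} [∀ n, NormedAddCommGroup (Wn n)]
    [∀ n, NormedSpace ℂ (Wn n)] (D : Data190 d M N Wn q) {V : LDom d → Type} [∀ Y, NormedAddCommGroup (V Y)]
    [∀ Y, NormedSpace ℂ (V Y)] (r : (n : ℕ) → (Y : LDom d) → Wn n →L[ℂ] V Y) (t : (Y : LDom d) → Pt d → V Y)
    (hN : Tendsto N atTop atTop) {S : LDom d → Kernel₂ d} {C δ : ℝ} (hS : ∀ Y n, IsPeriodic₂ (N n * M) (S Y))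
    (hdec : ∀ Y, Decay₂ (S Y) C δ) (hδ : 0 < δ) {ι : LDom d → Type} [∀ Y, Fintype (ι Y)]
    (e : (Y : LDom d) → ι Y → Pt d) (Φ : (Y : LDom d) → (ι Y → ℂ) →L[ℂ] V Y)
    (hid : ∀ (Y : LDom d) (x : Pt d) (n : ℕ),
      r n Y (D.hn n (tproj (N n) Y) (proj (N n * M) x)) =
        Φ Y (restrictCLM (N n * M) (e Y) fun y => (periodise₂ (N n * M) (S Y) y (proj (N n * M) x) : ℂ)))
    (ht : ∀ (Y : LDom d) (x : Pt d), t Y x = Φ Y fun i => (S Y (e Y i) x : ℂ)) :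
    ∀ (Y : LDom d) (x : Pt d),
      Tendsto (fun n => r n Y (D.hn n (tproj (N n) Y) (proj (N n * M) x))) atTop (𝓝 (t Y x)) := by
  intro Y x
  rw [ht Y x]
  exact (((Φ Y).continuous.tendsto _).comp (hconv_periodise₂_cubes (hS Y) (hdec Y) hδ hN (e Y) x)).congr
    fun n => (hid Y x n).symm

/-! ## §2 Reading (b): (1.21) from EVENTUAL CONSTANCY — window-truncated ℤ^d instruments ONLY -/

/-- [folklore] **(b) THE (1.21) CONVERGENCE FIELD FROM EVENTUAL CONSTANCY** — for instruments that make `n ↦ r n Y (h_n(Y, x))` eventually constant (window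
truncations of a fixed ℤ^d test configuration: constancy BY SUPPORT once the torus contains the window) the convergence field holds with that constant value;
no analysis.  NOT the reading for Bałaban's torus test configurations (periodised columns move with `n` — use §1). -/
theorem hconv_of_eventuallyEq {N : ℕ → ℕ} [∀ n, NeZero (N n)] {Wn : ℕ → Type} [∀ n, NormedAddCommGroup (Wn n)]
    [∀ n, NormedSpace ℂ (Wn n)] (D : Data190 d M N Wn q) {V : LDom d → Type} [∀ Y, NormedAddCommGroup (V Y)]
    [∀ Y, NormedSpace ℂ (V Y)] (r : (n : ℕ) → (Y : LDom d) → Wn n →L[ℂ] V Y) (t : (Y : LDom d) → Pt d → V Y)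
    (heq : ∀ (Y : LDom d) (x : Pt d), ∀ᶠ n in atTop, r n Y (D.hn n (tproj (N n) Y) (proj (N n * M) x)) = t Y x) :
    ∀ (Y : LDom d) (x : Pt d),
      Tendsto (fun n => r n Y (D.hn n (tproj (N n) Y) (proj (N n * M) x))) atTop (𝓝 (t Y x)) :=
  fun Y x => (tendsto_const_nhds (x := t Y x)).congr' ((heq Y x).mono fun _ h => h.symm)

end Summit.QuantumFields.BalabanUV.Gaps.D4NodeEConvergence

end
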